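import Literature.Analysis.Pluripotential.LeviForm
import Literature.LinearAlgebra.Matrix.PosSemidefPencilCoeff
import HarnessLib

/-!
# The Levi matrix of the Fubini–Study potential `½ log(1 + |w|²)`

Topic `Literature/Analysis/Pluripotential`. Explicit second-order calculus of the affine
Fubini–Study potential `fs(w) = ½ log (1 + Σ_p |w_p|²)` of
`Literature.AlgebraicGeometry.HodgeTheory.BiextensionHeight.fsPotential` on the chart `ℂⁿ` of
`ℙⁿ(ℂ)` (step (P2) of the proof of `BoucksomEtAl2010_regularMass_le_degree_pow`, see
`NonPluripolarMongeAmpereMassProofs.lean`; also the normalisation `∫ ω_FS^n = 1` of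
`heightDensity` later on):

* `hasFDerivAt_one_add_sum_norm_sq`, `hasFDerivAt_fsPotential`, `fderiv_fsPotential_eq`,
  `fderiv_fderiv_fsPotential_apply` — `D fs`, and
  `D²fs(w)(a,b) = Σ⟪a_p,b_p⟫/S - 2(Σ⟪w_p,a_p⟫)(Σ⟪w_p,b_p⟫)/S²`, `S = 1 + |w|²`
  (real inner product `⟪z,u⟫ = Re(z̄u)` on `ℂ`);
* `leviMatrix_fsPotential` — **`(∂²fs/∂w_p∂w̄_q) = δ_{pq}/(2S) - w̄_p w_q/(2S²)`**, i.e.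
  `leviMatrix fs w = (2S)⁻¹ (1 - S⁻¹ w̄wᵀ)` (the matrix of `ω_FS = dd^c fs` in the chart);
* `posDef_leviMatrix_fsPotential` — it is positive definite, with coercivity `Σ|x_i|²/(2S²)`
  (Cauchy–Schwarz), `det_leviMatrix_fsPotential` — `det = (2ⁿ Sⁿ⁺¹)⁻¹` (matrix determinant
  lemma), so that `n!(2/π)ⁿ det = n! π⁻ⁿ (1+|w|²)^{-n-1}`, the density of `ω_FS^n`;
* `contDiff_fsPotential` — `fs` is `C^∞`.
* `heightDensity_nonneg_of_posSemidef` — **a positive semidefinite Levi matrix gives non-negative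
  height densities in every order**: `heightDensity j G w = n!(2/π)ⁿ/C(n,j) · Re [sʲ] det(s A + G_FS)`
  with `A = leviMatrix G w ⪰ 0` and `G_FS = leviMatrix fs w ≻ 0`
  (`Literature.LinearAlgebra.Matrix.coeff_det_X_smul_add_re_nonneg`).

## References

Standard (e.g. P. Griffiths, J. Harris, Principles of Algebraic Geometry (1978), Ch. 0 §2,
"the Fubini–Study metric"; C. Voisin, Hodge Theory and Complex Algebraic Geometry I (2002),
§3.3.2, Lemma 3.16). All statements here are [folklore] computations.
-/

noncomputable section

open scoped Topology InnerProductSpace ComplexConjugate ComplexOrder Matrix ContDiff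
open Filter Set Metric Complex
open Literature.AlgebraicGeometry.HodgeTheory.BiextensionHeight (leviMatrix fsPotential heightDensity)

namespace Literature.Analysis.Pluripotential

variable {n : ℕ}

/-- The derivative of `w ↦ 1 + Σ_p |w_p|²` on `ℂⁿ`: `h ↦ 2 Σ_p ⟪w_p, h_p⟫_ℝ`. [folklore] -/
theorem hasFDerivAt_one_add_sum_norm_sq (w : Fin n → ℂ) :
    HasFDerivAt (fun w : Fin n → ℂ ↦ 1 + ∑ p, ‖w p‖ ^ 2)
      (∑ p, ((2 : ℝ) • innerSL ℝ (w p)).comp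
        (ContinuousLinearMap.proj p : (Fin n → ℂ) →L[ℝ] ℂ)) w := by
  have h : ∀ p : Fin n, HasFDerivAt (fun w : Fin n → ℂ ↦ ‖w p‖ ^ 2)
      (((2 : ℝ) • innerSL ℝ (w p)).comp (ContinuousLinearMap.proj p : (Fin n → ℂ) →L[ℝ] ℂ)) w :=
    fun p ↦ by
    have := (hasStrictFDerivAt_norm_sq (w p)).hasFDerivAt.comp w
      (ContinuousLinearMap.proj p : (Fin n → ℂ) →L[ℝ] ℂ).hasFDerivAt
    rw [← Nat.cast_smul_eq_nsmul ℝ, Nat.cast_ofNat] at this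
    exact this
  exact (HasFDerivAt.fun_sum (u := Finset.univ) fun p _ ↦ h p).const_add 1

/-- The derivative of `w ↦ 1 + Σ_p |w_p|²` is linear in `w`: it is the value at `w` of a bundled
continuous linear map. [folklore] -/
theorem sum_innerSL_comp_proj_eq (w : Fin n → ℂ) :
    (∑ p, ((2 : ℝ) • innerSL ℝ (w p)).comp (ContinuousLinearMap.proj p : (Fin n → ℂ) →L[ℝ] ℂ)) =
      (∑ p : Fin n, (2 : ℝ) • (((ContinuousLinearMap.compL ℝ (Fin n → ℂ) ℂ ℝ).flip
        (ContinuousLinearMap.proj p : (Fin n → ℂ) →L[ℝ] ℂ)).comp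
          ((innerSL ℝ : ℂ →L[ℝ] ℂ →L[ℝ] ℝ).comp
            (ContinuousLinearMap.proj p : (Fin n → ℂ) →L[ℝ] ℂ)))) w := by
  simp only [FunLike.coe_sum, Finset.sum_apply]
  refine Finset.sum_congr rfl fun p _ ↦ ?_
  ext h
  simp

/-- `1 + Σ_p |w_p|² > 0`. [folklore] -/
theorem one_add_sum_norm_sq_pos (w : Fin n → ℂ) : 0 < 1 + ∑ p, ‖w p‖ ^ 2 := by positivity

/-- `fsPotential = ½ log(1 + Σ|w_p|²)` written with a scalar factor. [folklore] -/
theorem fsPotential_eq_smul_log :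
    (fsPotential : (Fin n → ℂ) → ℝ) = fun w ↦ (2 : ℝ)⁻¹ • Real.log (1 + ∑ p, ‖w p‖ ^ 2) := by
  funext w
  simp only [fsPotential, smul_eq_mul]
  ring

/-- **First derivative of the Fubini–Study potential**:
`D fs(w) = (2(1+|w|²))⁻¹ · D(1+|w|²)(w)`. [folklore] -/
theorem hasFDerivAt_fsPotential (w : Fin n → ℂ) :
    HasFDerivAt (fsPotential : (Fin n → ℂ) → ℝ)
      ((2 * (1 + ∑ p, ‖w p‖ ^ 2))⁻¹ •
        ∑ p, ((2 : ℝ) • innerSL ℝ (w p)).comp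
          (ContinuousLinearMap.proj p : (Fin n → ℂ) →L[ℝ] ℂ)) w := by
  have hS := hasFDerivAt_one_add_sum_norm_sq w
  have hlog := hS.log (one_add_sum_norm_sq_pos w).ne'
  have := hlog.const_smul (2 : ℝ)⁻¹
  rw [fsPotential_eq_smul_log, mul_inv, ← smul_smul]
  exact this

/-- The derivative of the Fubini–Study potential as a function. [folklore] -/
theorem fderiv_fsPotential_eq :
    fderiv ℝ (fsPotential : (Fin n → ℂ) → ℝ) = fun w ↦ (2 * (1 + ∑ p, ‖w p‖ ^ 2))⁻¹ •
      (∑ p : Fin n, (2 : ℝ) • (((ContinuousLinearMap.compL ℝ (Fin n → ℂ) ℂ ℝ).flip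
        (ContinuousLinearMap.proj p : (Fin n → ℂ) →L[ℝ] ℂ)).comp
          ((innerSL ℝ : ℂ →L[ℝ] ℂ →L[ℝ] ℝ).comp
            (ContinuousLinearMap.proj p : (Fin n → ℂ) →L[ℝ] ℂ)))) w := by
  funext w
  rw [(hasFDerivAt_fsPotential w).fderiv, sum_innerSL_comp_proj_eq]

/-- **Second derivative of the Fubini–Study potential** `fs(w) = ½ log(1 + Σ|w_p|²)`:
`D²fs(w)(a, b) = Σ⟪a_p,b_p⟫/S - 2 (Σ⟪w_p,a_p⟫)(Σ⟪w_p,b_p⟫)/S²`, `S = 1 + Σ|w_p|²`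
(real inner product `⟪z, u⟫ = Re(z̄u)` on `ℂ`). [folklore] -/
theorem fderiv_fderiv_fsPotential_apply (w a b : Fin n → ℂ) :
    fderiv ℝ (fderiv ℝ (fsPotential : (Fin n → ℂ) → ℝ)) w a b =
      (∑ p, ⟪a p, b p⟫_ℝ) / (1 + ∑ p, ‖w p‖ ^ 2)
        - 2 * (∑ p, ⟪w p, a p⟫_ℝ) * (∑ p, ⟪w p, b p⟫_ℝ) / (1 + ∑ p, ‖w p‖ ^ 2) ^ 2 := by
  set S : (Fin n → ℂ) → ℝ := fun w ↦ 1 + ∑ p, ‖w p‖ ^ 2 with hSdef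
  set Λ : (Fin n → ℂ) →L[ℝ] (Fin n → ℂ) →L[ℝ] ℝ :=
    ∑ p : Fin n, (2 : ℝ) • (((ContinuousLinearMap.compL ℝ (Fin n → ℂ) ℂ ℝ).flip
      (ContinuousLinearMap.proj p : (Fin n → ℂ) →L[ℝ] ℂ)).comp
        ((innerSL ℝ : ℂ →L[ℝ] ℂ →L[ℝ] ℝ).comp
          (ContinuousLinearMap.proj p : (Fin n → ℂ) →L[ℝ] ℂ))) with hΛ
  have hΛapp : ∀ u v : Fin n → ℂ, Λ u v = ∑ p, 2 * ⟪u p, v p⟫_ℝ := by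
    intro u v
    simp [hΛ]
  -- the scalar factor and its derivative
  have hS : HasFDerivAt S (Λ w) w := by
    have := hasFDerivAt_one_add_sum_norm_sq w
    rwa [sum_innerSL_comp_proj_eq] at this
  have hSpos : 0 < S w := one_add_sum_norm_sq_pos w
  have hφ : HasFDerivAt (fun y ↦ (2 * S y)⁻¹) ((-2 / (2 * S w) ^ 2) • Λ w) w := by
    have h1 : HasDerivAt (fun t : ℝ ↦ (2 * t)⁻¹) (-2 / (2 * S w) ^ 2) (S w) := by
      have := ((hasDerivAt_id (S w)).const_mul (2 : ℝ)).inv (by simp [hSpos.ne'])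
      simp only [mul_one, id_eq] at this
      exact this
    exact h1.comp_hasFDerivAt w hS
  -- the derivative of `D fs = φ • Λ`
  have hD : HasFDerivAt (fderiv ℝ (fsPotential : (Fin n → ℂ) → ℝ))
      ((2 * S w)⁻¹ • Λ + ((-2 / (2 * S w) ^ 2) • Λ w).smulRight (Λ w)) w := by
    rw [fderiv_fsPotential_eq]
    exact hφ.smul Λ.hasFDerivAt
  rw [hD.fderiv]
  simp only [add_apply, smul_apply, ContinuousLinearMap.smulRight_apply, hΛapp, smul_eq_mul]
  rw [← Finset.mul_sum, ← Finset.mul_sum, ← Finset.mul_sum]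
  field_simp
  ring

/-- The real inner product of `ℂ` in coordinates: `⟪z, u⟫_ℝ = Re z Re u + Im z Im u`. [folklore] -/
theorem real_inner_complex_eq (z u : ℂ) : ⟪z, u⟫_ℝ = z.re * u.re + z.im * u.im := by
  rw [Complex.inner]; simp [Complex.mul_re]; ring

/-- Sums of inner products of multiples of standard basis vectors. [folklore] -/
theorem sum_inner_smul_single_smul_single (u v : ℂ) (p q : Fin n) :
    ∑ r, ⟪(u • (Pi.single p (1 : ℂ) : Fin n → ℂ)) r, (v • (Pi.single q (1 : ℂ) : Fin n → ℂ)) r⟫_ℝ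
      = if p = q then ⟪u, v⟫_ℝ else 0 := by
  rw [Finset.sum_eq_single p]
  · by_cases hpq : p = q
    · subst hpq; simp
    · simp [hpq]
  · intro r _ hrp
    simp [Pi.single_apply, hrp]
  · simp

/-- Sums of inner products against a multiple of a standard basis vector. [folklore] -/
theorem sum_inner_smul_single (w : Fin n → ℂ) (u : ℂ) (p : Fin n) :
    ∑ r, ⟪w r, (u • (Pi.single p (1 : ℂ) : Fin n → ℂ)) r⟫_ℝ = ⟪w p, u⟫_ℝ := by
  rw [Finset.sum_eq_single p]
  · simp
  · intro r _ hrp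
    simp [hrp]
  · simp


/-- **The Levi matrix of the Fubini–Study potential**: for `fs(w) = ½ log(1 + |w|²)` on the chart
`ℂⁿ` of `ℙⁿ`, `(∂²fs/∂w_p∂w̄_q)(w) = δ_{pq}/(2S) - w̄_p w_q/(2S²)`, `S = 1 + |w|²`, i.e.
`leviMatrix fs w = (2S)⁻¹ (1 - S⁻¹ w̄ wᵀ)`. [folklore] -/
theorem leviMatrix_fsPotential (w : Fin n → ℂ) :
    leviMatrix fsPotential w =
      (((2 * (1 + ∑ p, ‖w p‖ ^ 2))⁻¹ : ℝ) : ℂ) •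
        (1 - (((1 + ∑ p, ‖w p‖ ^ 2)⁻¹ : ℝ) : ℂ) • Matrix.vecMulVec (star w) w) := by
  set S : ℝ := 1 + ∑ p, ‖w p‖ ^ 2 with hS
  have hSpos : 0 < S := one_add_sum_norm_sq_pos w
  ext p q
  rw [leviMatrix_apply]
  simp only [fderiv_fderiv_fsPotential_apply, ← hS]
  -- evaluate the sums of inner products on basis vectors
  have P11 : ∑ r, ⟪(Pi.single p (1 : ℂ) : Fin n → ℂ) r, (Pi.single q (1 : ℂ) : Fin n → ℂ) r⟫_ℝ =
      if p = q then 1 else 0 := by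
    simpa [real_inner_complex_eq] using sum_inner_smul_single_smul_single (n := n) 1 1 p q
  have PII : ∑ r, ⟪(I • (Pi.single p (1 : ℂ) : Fin n → ℂ)) r, (I • (Pi.single q (1 : ℂ) : Fin n → ℂ)) r⟫_ℝ =
      if p = q then 1 else 0 := by
    simpa [real_inner_complex_eq] using sum_inner_smul_single_smul_single (n := n) I I p q
  have P1I : ∑ r, ⟪(Pi.single p (1 : ℂ) : Fin n → ℂ) r, (I • (Pi.single q (1 : ℂ) : Fin n → ℂ)) r⟫_ℝ = 0 := by
    simpa [real_inner_complex_eq] using sum_inner_smul_single_smul_single (n := n) 1 I p q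
  have PI1 : ∑ r, ⟪(I • (Pi.single p (1 : ℂ) : Fin n → ℂ)) r, (Pi.single q (1 : ℂ) : Fin n → ℂ) r⟫_ℝ = 0 := by
    simpa [real_inner_complex_eq] using sum_inner_smul_single_smul_single (n := n) I 1 p q
  have Q1 : ∀ p : Fin n, ∑ r, ⟪w r, (Pi.single p (1 : ℂ) : Fin n → ℂ) r⟫_ℝ = (w p).re := fun p ↦ by
    simpa [real_inner_complex_eq] using sum_inner_smul_single w 1 p
  have QI : ∀ p : Fin n, ∑ r, ⟪w r, (I • (Pi.single p (1 : ℂ) : Fin n → ℂ)) r⟫_ℝ = (w p).im := fun p ↦ by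
    simpa [real_inner_complex_eq] using sum_inner_smul_single w I p
  rw [P11, PII, P1I, PI1, Q1 p, Q1 q, QI p, QI q]
  simp only [Matrix.smul_apply, Matrix.sub_apply, Matrix.one_apply, Matrix.vecMulVec_apply,
    Pi.star_apply, Complex.star_def, smul_eq_mul]
  by_cases hpq : p = q
  · subst hpq
    simp only [if_true]
    apply Complex.ext
    · simp only [Complex.div_ofNat_re, Complex.add_re, Complex.sub_re, Complex.mul_re,
        Complex.mul_im, Complex.ofReal_re, Complex.ofReal_im, Complex.I_re, Complex.I_im,
        Complex.conj_re, Complex.conj_im, Complex.one_re]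
      field_simp
      ring
    · simp only [Complex.div_ofNat_im, Complex.add_im, Complex.sub_im, Complex.mul_re,
        Complex.mul_im, Complex.ofReal_re, Complex.ofReal_im, Complex.I_re, Complex.I_im,
        Complex.conj_re, Complex.conj_im, Complex.one_im]
      field_simp
      ring
  · simp only [hpq, if_false]
    apply Complex.ext
    · simp only [Complex.div_ofNat_re, Complex.add_re, Complex.sub_re, Complex.mul_re,
        Complex.mul_im, Complex.ofReal_re, Complex.ofReal_im, Complex.I_re, Complex.I_im,
        Complex.conj_re, Complex.conj_im, Complex.zero_re]
      field_simp
      ring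
    · simp only [Complex.div_ofNat_im, Complex.add_im, Complex.sub_im, Complex.mul_re,
        Complex.mul_im, Complex.ofReal_re, Complex.ofReal_im, Complex.I_re, Complex.I_im,
        Complex.conj_re, Complex.conj_im, Complex.zero_im]
      field_simp
      ring

/-- `(u vᵀ) x = (v · x) u`. [folklore] -/
theorem vecMulVec_mulVec (u v x : Fin n → ℂ) :
    Matrix.vecMulVec u v *ᵥ x = (v ⬝ᵥ x) • u := by
  ext i
  simp [Matrix.mulVec, dotProduct, Matrix.vecMulVec_apply, Finset.mul_sum, mul_comm,
    mul_left_comm]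

/-- `x̄ · x = Σ |x_i|²` in `ℂ`. [folklore] -/
theorem star_dotProduct_self_eq (x : Fin n → ℂ) :
    star x ⬝ᵥ x = ((∑ i, ‖x i‖ ^ 2 : ℝ) : ℂ) := by
  simp only [dotProduct, Pi.star_apply, Complex.star_def, Complex.ofReal_sum, Complex.ofReal_pow]
  refine Finset.sum_congr rfl fun i _ ↦ ?_
  rw [← Complex.normSq_eq_conj_mul_self, Complex.normSq_eq_norm_sq, Complex.ofReal_pow]

/-- `w · w̄ = Σ |w_i|²` in `ℂ`. [folklore] -/
theorem dotProduct_star_self_eq (w : Fin n → ℂ) :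
    w ⬝ᵥ star w = ((∑ i, ‖w i‖ ^ 2 : ℝ) : ℂ) := by
  rw [dotProduct_comm]; exact star_dotProduct_self_eq w

/-- Cauchy–Schwarz for the bilinear dot product on `ℂⁿ`: `|w · x|² ≤ (Σ|w_i|²)(Σ|x_i|²)`.
[folklore] -/
theorem norm_dotProduct_sq_le (w x : Fin n → ℂ) :
    ‖w ⬝ᵥ x‖ ^ 2 ≤ (∑ i, ‖w i‖ ^ 2) * ∑ i, ‖x i‖ ^ 2 := by
  have h1 : ‖w ⬝ᵥ x‖ ≤ ∑ i, ‖w i‖ * ‖x i‖ := by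
    simp only [dotProduct]
    exact (norm_sum_le _ _).trans (Finset.sum_le_sum fun i _ ↦ (norm_mul_le _ _))
  calc ‖w ⬝ᵥ x‖ ^ 2 ≤ (∑ i, ‖w i‖ * ‖x i‖) ^ 2 := by gcongr
    _ ≤ (∑ i, ‖w i‖ ^ 2) * ∑ i, ‖x i‖ ^ 2 := Finset.sum_mul_sq_le_sq_mul_sq _ _ _

/-- The quadratic form of the rank-one-corrected identity `a (1 - b w̄ wᵀ)` on `ℂⁿ`:
`x̄ᵀ (a(1 - b w̄wᵀ)) x = a (Σ|x_i|² - b |w · x|²)` (real scalars `a, b`). [folklore] -/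
theorem star_dotProduct_smul_one_sub_mulVec (a b : ℝ) (w x : Fin n → ℂ) :
    star x ⬝ᵥ (((a : ℂ) • (1 - (b : ℂ) • Matrix.vecMulVec (star w) w)) *ᵥ x) =
      ((a * (∑ i, ‖x i‖ ^ 2 - b * ‖w ⬝ᵥ x‖ ^ 2) : ℝ) : ℂ) := by
  rw [Matrix.smul_mulVec, Matrix.sub_mulVec, Matrix.one_mulVec, Matrix.smul_mulVec,
    vecMulVec_mulVec, dotProduct_smul, dotProduct_sub, dotProduct_smul, dotProduct_smul,
    Matrix.star_dotProduct_star, star_dotProduct_self_eq, Complex.star_def,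
    smul_eq_mul, smul_eq_mul, smul_eq_mul, Complex.mul_conj, Complex.normSq_eq_norm_sq]
  push_cast
  ring

/-- **The Fubini–Study Levi matrix is positive definite**, with the explicit coercivity
`x̄ᵀ G x ≥ Σ|x_i|² / (2 S²)`, `S = 1 + |w|²` (Cauchy–Schwarz), for the matrix
`G = (2S)⁻¹(1 - S⁻¹ w̄ wᵀ)` of `leviMatrix_fsPotential`. [folklore] -/
theorem posDef_smul_one_sub_vecMulVec (w : Fin n → ℂ) :
    ((((2 * (1 + ∑ p, ‖w p‖ ^ 2))⁻¹ : ℝ) : ℂ) •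
        (1 - (((1 + ∑ p, ‖w p‖ ^ 2)⁻¹ : ℝ) : ℂ) • Matrix.vecMulVec (star w) w)).PosDef := by
  set S : ℝ := 1 + ∑ p, ‖w p‖ ^ 2 with hS
  have hSpos : 0 < S := by positivity
  refine Matrix.PosDef.of_dotProduct_mulVec_pos ?_ fun x hx ↦ ?_
  · -- Hermitian
    have h1 : (Matrix.vecMulVec (star w) w).IsHermitian := by
      rw [Matrix.IsHermitian, Matrix.conjTranspose_vecMulVec, star_star]
    have h2 : ((((S⁻¹ : ℝ)) : ℂ) • Matrix.vecMulVec (star w) w).IsHermitian := by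
      rw [Matrix.IsHermitian, Matrix.conjTranspose_smul, h1.eq, Complex.star_def,
        Complex.conj_ofReal]
    have h3 := Matrix.isHermitian_one.sub h2
    rw [Matrix.IsHermitian, Matrix.conjTranspose_smul, h3.eq, Complex.star_def, Complex.conj_ofReal]
  · rw [star_dotProduct_smul_one_sub_mulVec, Complex.zero_lt_real]
    have hX : 0 < ∑ i, ‖x i‖ ^ 2 := by
      obtain ⟨i, hi⟩ := Function.ne_iff.mp hx
      exact lt_of_lt_of_le (by positivity : 0 < ‖x i‖ ^ 2)
        (Finset.single_le_sum (f := fun j ↦ ‖x j‖ ^ 2) (fun j _ ↦ by positivity)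
          (Finset.mem_univ i))
    have hCS := norm_dotProduct_sq_le w x
    have hkey : S⁻¹ * ‖w ⬝ᵥ x‖ ^ 2 ≤ (S - 1) / S * ∑ i, ‖x i‖ ^ 2 := by
      rw [inv_mul_eq_div, div_mul_eq_mul_div, div_le_div_iff_of_pos_right hSpos]
      have : S - 1 = ∑ i, ‖w i‖ ^ 2 := by rw [hS]; ring
      rw [this]; exact hCS
    have hlt : (S - 1) / S * ∑ i, ‖x i‖ ^ 2 < ∑ i, ‖x i‖ ^ 2 := by
      have : (S - 1) / S < 1 := by rw [div_lt_one hSpos]; linarith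
      nlinarith
    exact mul_pos (by positivity) (by linarith)

/-- **The determinant of the Fubini–Study Levi matrix**: `det G = (2ⁿ Sⁿ⁺¹)⁻¹`, `S = 1 + |w|²`
(matrix determinant lemma `det(1 - b w̄wᵀ) = 1 - b |w|²`). Consequently
`n! (2/π)ⁿ det G = n! π⁻ⁿ (1 + |w|²)^{-n-1}`, the density of `ω_FS^n`, of total mass `1`.
[folklore] -/
theorem det_smul_one_sub_vecMulVec (w : Fin n → ℂ) :
    ((((2 * (1 + ∑ p, ‖w p‖ ^ 2))⁻¹ : ℝ) : ℂ) •
        (1 - (((1 + ∑ p, ‖w p‖ ^ 2)⁻¹ : ℝ) : ℂ) • Matrix.vecMulVec (star w) w)).det =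
      ((((2 : ℝ) ^ n * (1 + ∑ p, ‖w p‖ ^ 2) ^ (n + 1))⁻¹ : ℝ) : ℂ) := by
  set S : ℝ := 1 + ∑ p, ‖w p‖ ^ 2 with hS
  have hSpos : 0 < S := by positivity
  have hrank : (1 - (((S⁻¹ : ℝ)) : ℂ) • Matrix.vecMulVec (star w) w).det = ((S⁻¹ : ℝ) : ℂ) := by
    have : (((S⁻¹ : ℝ)) : ℂ) • Matrix.vecMulVec (star w) w =
        Matrix.replicateCol Unit ((((S⁻¹ : ℝ)) : ℂ) • star w) * Matrix.replicateRow Unit w := by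
      rw [← Matrix.vecMulVec_eq, Matrix.smul_vecMulVec]
    rw [this, Matrix.det_one_sub_mul_comm, Matrix.det_unique]
    simp only [Matrix.sub_apply, Matrix.one_apply_eq, Matrix.replicateRow_mul_replicateCol_apply,
      dotProduct_smul, dotProduct_star_self_eq, smul_eq_mul]
    have hsum : ((∑ i, ‖w i‖ ^ 2 : ℝ) : ℂ) = (S : ℂ) - 1 := by rw [hS]; push_cast; ring
    have hS' : (S : ℂ) ≠ 0 := by exact_mod_cast hSpos.ne'
    rw [hsum]
    push_cast
    field_simp
    ring
  have hS' : (S : ℂ) ≠ 0 := by exact_mod_cast hSpos.ne'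
  rw [Matrix.det_smul, hrank, Fintype.card_fin]
  push_cast
  rw [inv_pow, ← mul_inv, mul_pow, pow_succ]
  ring


/-- **The Fubini–Study Levi matrix `leviMatrix fs w` is positive definite.** [folklore] -/
theorem posDef_leviMatrix_fsPotential (w : Fin n → ℂ) : (leviMatrix fsPotential w).PosDef := by
  rw [leviMatrix_fsPotential]
  exact posDef_smul_one_sub_vecMulVec w

/-- **`det (leviMatrix fs w) = (2ⁿ (1 + |w|²)ⁿ⁺¹)⁻¹`.** [folklore] -/
theorem det_leviMatrix_fsPotential (w : Fin n → ℂ) :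
    (leviMatrix fsPotential w).det =
      ((((2 : ℝ) ^ n * (1 + ∑ p, ‖w p‖ ^ 2) ^ (n + 1))⁻¹ : ℝ) : ℂ) := by
  rw [leviMatrix_fsPotential]
  exact det_smul_one_sub_vecMulVec w

/-- The Fubini–Study potential is `C^∞` on the chart. [folklore] -/
theorem contDiff_fsPotential : ContDiff ℝ ∞ (fsPotential : (Fin n → ℂ) → ℝ) := by
  have h : ContDiff ℝ ∞ fun w : Fin n → ℂ ↦ 1 + ∑ p, ‖w p‖ ^ 2 :=
    contDiff_const.add (ContDiff.sum fun p _ ↦ (contDiff_norm_sq ℝ).comp (contDiff_apply ℝ ℂ p))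
  have : (fsPotential : (Fin n → ℂ) → ℝ) = fun w ↦ Real.log (1 + ∑ p, ‖w p‖ ^ 2) / 2 := rfl
  rw [this]
  exact (h.log fun w ↦ (one_add_sum_norm_sq_pos w).ne').div_const 2


/-- **Non-negativity of the height densities for a positive semidefinite Levi matrix**: if
`leviMatrix G w ⪰ 0` then `0 ≤ heightDensity j G w` for every `j` (the density of
`(dd^c G)^j ∧ ω_FS^{n-j}` at `w` is `n!(2/π)ⁿ/C(n,j)` times the `j`-th coefficient of
`det(s · leviMatrix G w + leviMatrix fs w)`, non-negative by `coeff_det_X_smul_add_re_nonneg` as the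
Fubini–Study Levi matrix is positive definite). [folklore] -/
theorem heightDensity_nonneg_of_posSemidef {G : (Fin n → ℂ) → ℝ} {w : Fin n → ℂ}
    (h : (leviMatrix G w).PosSemidef) (j : ℕ) : 0 ≤ heightDensity j G w := by
  have hc := (Literature.LinearAlgebra.Matrix.coeff_det_X_smul_add_re_nonneg h
    (posDef_leviMatrix_fsPotential w) j).1
  unfold heightDensity
  exact mul_nonneg (by positivity) hc

end Literature.Analysis.Pluripotential

end
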